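import Literature.MathematicalPhysics.QuantumFieldTheory.BalabanImbrieJaffe1984to88.BIJ88Sect3Statements

/-!
# `BalabanImbrieJaffe1984to88.BIJ88Decomposition314` — T. Bałaban, J. Imbrie, A. Jaffe, *Effective action and cluster
properties of the abelian Higgs model*, Commun. Math. Phys. **114** (1988) 257–315 [BalabanImbrieJaffe1988]: the
large/small-field partition of unity (3.14) p. 267 and the expansion (3.37) p. 271 "χ = 1 − χ^c", TYPED AND PROVED

statement-level skeleton of published theorems with citation tags; proofs where landed; nothing here is a claim about the Yang–Mills mass gap

PDF held: `paper:balaban1988-cmp114-bij-abelian-higgs-effective-action` (journal page = PDF page + 256).  Renders read as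
images (poppler ×3): PDF pp. 11, 15 (journal 267, 271).

CITATION HEADER (lean-in-tree rule).  Part of the lit-balaban TYPED SKELETON (HOME `run/shared/lean/pub/lit-balaban/`; rows
`C2.Eq3.14` and `C2.Eq3.37` of `HOME/lit-balaban-r18/ROWS-C2.md`; unit `lit-balaban-r18`, gen 2).  WHAT IS REPRODUCED, verbatim,
p. 267 [PDF 11]: *"The first operation is a decomposition of the lattice into large and small field regions. This is accomplished
by means of a partition of unity, 1 = Σ_{Λ₀^{(0)}} ζ_{Λ₀^{(0)c}} χ_{Λ₀^{(0)}}. (3.14) Here Λ₀^{(0)} ⊂ T₁ is the small field region.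
It is composed of r(e₀)-cubes, in each of which the factor χ_{Λ₀^{(0)}} enforces the following conditions: … (3.15) The factor
ζ_{Λ₀^{(0)c}} forces at least one of these conditions to be violated somewhere in each r(e₀)-cube of Λ₀^{(0)c}."*; p. 271 [PDF 15]:
*"This means we expand each characteristic function as χ = 1 − χ^c. We obtain a sum of regions Λ̃₉^{(0)} which contains only
1-terms: χ_{Λ₉^{(0)}} = Σ_{Λ̃₉^{(0)}} ζ′_{Λ̃₉^{(0)c}}. (3.37)"*.
TYPED READING.  The unit lattice is covered by a finite set `cubes` of r(e₀)-cubes (index type `κ`); a characteristic function is a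
per-cube factor `χ □ ∈ ℝ` (sharp: `χ □ ∈ {0,1}`, §2), `χ_{Λ₀} = Π_{□∈Λ₀} χ □`, `ζ_{Y} = Π_{□∈Y} (1 − χ □)` (*"violated somewhere in
each cube of"* `Y = Λ₀^c`), `ζ′_{Y} = Π_{□∈Y} (−χ^c □)`.  PROVED (kernel-checked, every finite `cubes`, every `χ`): (3.14) as the
expansion of `Π_□ (χ □ + (1 − χ □)) = 1` (`eq314`); (3.37) as the expansion of `Π_{□∈Λ₉} (1 + (−χ^c □))` (`eq337`); for SHARP
characteristic functions the sum (3.14) has exactly one non-zero term, the small-field region `Λ₀ = {□ : the (3.15) conditions hold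
in □}` (`term314_indicator`, `eq314_indicator_support`), and `ζ_Y = 1 ↔` the conditions fail in every cube of `Y` (`zeta_indicator`);
§3 instantiates `χ □` with the indicator of the tree's (3.15) predicate `BIJ88Sect3Statements.SmallField315` on the sites / block
sites of the cube `□` (`chi315`, `eq314_smallField`).  NOT HERE: the smoothness of the later cutoffs, the sets Λ₁^{(0)}, …, Λ₁₃^{(0)}
obtained by deleting collars (p. 267), anything of (3.16)–(3.36); the cubes' geometry is data (`sites`, `blockSites`), not constructed.
-/

namespace Literature.MathematicalPhysics.QuantumFieldTheory.BalabanImbrieJaffe1984to88.BIJ88Decomposition314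

open scoped BigOperators
open Finset

noncomputable section

variable {κ : Type*}

/-! ## §1 Characteristic-function algebra over a finite set of cubes: (3.14) and (3.37) for arbitrary factors -/

/-- `χ_{Λ₀} = Π_{□ ∈ Λ₀} χ_□` — the characteristic function of the region `Λ₀` (a finite set of r(e₀)-cubes) as the product of the
per-cube factors, p. 267: *"It is composed of r(e₀)-cubes, in each of which the factor χ_{Λ₀^{(0)}} enforces the following
conditions"*. [cite: BalabanImbrieJaffe1988, (3.14) p.267] -/
def chi (χ : κ → ℝ) (Λ₀ : Finset κ) : ℝ := ∏ q ∈ Λ₀, χ q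

/-- `ζ_{Y} = Π_{□ ∈ Y} (1 − χ_□)` — p. 267: *"The factor ζ_{Λ₀^{(0)c}} forces at least one of these conditions to be violated
somewhere in each r(e₀)-cube of Λ₀^{(0)c}"* (`Y = Λ₀^c`). [cite: BalabanImbrieJaffe1988, (3.14) p.267] -/
def zeta (χ : κ → ℝ) (Y : Finset κ) : ℝ := ∏ q ∈ Y, (1 - χ q)

/-- `ζ′_{Y} = Π_{□ ∈ Y} (−χ^c_□)` — the factors of the expansion "χ = 1 − χ^c" of (3.37), p. 271 (`χc □` = the complementary
characteristic function `χ^c` of the cube). [cite: BalabanImbrieJaffe1988, (3.37) p.271] -/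
def zetaPrime (χc : κ → ℝ) (Y : Finset κ) : ℝ := ∏ q ∈ Y, (-χc q)

/-- unfolding: `χ_∅ = 1`. [cite: BalabanImbrieJaffe1988, (3.14) p.267] -/
theorem chi_empty (χ : κ → ℝ) : chi χ ∅ = 1 := by simp [chi]

/-- unfolding: `ζ_∅ = 1`. [cite: BalabanImbrieJaffe1988, (3.14) p.267] -/
theorem zeta_empty (χ : κ → ℝ) : zeta χ ∅ = 1 := by simp [zeta]

/-- multiplicativity over disjoint regions: `χ_{X ∪ X'} = χ_X χ_{X'}`. [cite: BalabanImbrieJaffe1988, (3.14) p.267] -/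
theorem chi_union [DecidableEq κ] (χ : κ → ℝ) {X X' : Finset κ} (h : Disjoint X X') :
    chi χ (X ∪ X') = chi χ X * chi χ X' := by
  simp only [chi, prod_union h]

/-- **(3.14)** p. 267 [PDF 11], verbatim: *"This is accomplished by means of a partition of unity, 1 = Σ_{Λ₀^{(0)}} ζ_{Λ₀^{(0)c}}
χ_{Λ₀^{(0)}}. (3.14)"* — PROVED for every finite set of cubes and every family of per-cube factors: the sum over all regions
`Λ₀ ⊆ cubes` of `ζ_{cubes ∖ Λ₀} χ_{Λ₀}` is `Π_□ ((1 − χ_□) + χ_□) = 1`. [cite: BalabanImbrieJaffe1988, (3.14) p.267] -/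
theorem eq314 [DecidableEq κ] (cubes : Finset κ) (χ : κ → ℝ) :
    ∑ Λ₀ ∈ cubes.powerset, zeta χ (cubes \ Λ₀) * chi χ Λ₀ = 1 := by
  have h := Finset.prod_add (fun q => χ q) (fun q => 1 - χ q) cubes
  simp only [add_sub_cancel, prod_const_one] at h
  rw [h]
  refine sum_congr rfl fun Λ₀ _ => ?_
  simp only [zeta, chi, mul_comm]

/-- **(3.37)** p. 271 [PDF 15], verbatim: *"This means we expand each characteristic function as χ = 1 − χ^c. We obtain a sum of
regions Λ̃₉^{(0)} which contains only 1-terms: χ_{Λ₉^{(0)}} = Σ_{Λ̃₉^{(0)}} ζ′_{Λ̃₉^{(0)c}}. (3.37)"* — PROVED: with `χ_□ = 1 − χ^c_□`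
in every cube of `Λ₉`, `Π_{□∈Λ₉} (1 − χ^c_□) = Σ_{Λ̃₉ ⊆ Λ₉} Π_{□ ∈ Λ₉ ∖ Λ̃₉} (−χ^c_□)` (the `Λ̃₉` are the cubes where the `1` is
chosen, the complement `Λ₉ ∖ Λ̃₉` carries `ζ′`). [cite: BalabanImbrieJaffe1988, (3.37) p.271] -/
theorem eq337 [DecidableEq κ] (Λ₉ : Finset κ) (χc : κ → ℝ) :
    ∏ q ∈ Λ₉, (1 - χc q) = ∑ Λt ∈ Λ₉.powerset, zetaPrime χc (Λ₉ \ Λt) := by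
  have h := Finset.prod_add (fun _ => (1 : ℝ)) (fun q => -χc q) Λ₉
  simp only [prod_const_one, one_mul] at h
  simpa only [sub_eq_add_neg, zetaPrime] using h

/-- (3.37) in the `χ`-notation of (3.14): `χ_{Λ₉} = Σ_{Λ̃₉ ⊆ Λ₉} ζ′_{Λ₉ ∖ Λ̃₉}` with `χ^c_□ := 1 − χ_□`.
[cite: BalabanImbrieJaffe1988, (3.37) p.271] -/
theorem chi_eq_sum_zetaPrime [DecidableEq κ] (Λ₉ : Finset κ) (χ : κ → ℝ) :
    chi χ Λ₉ = ∑ Λt ∈ Λ₉.powerset, zetaPrime (fun q => 1 - χ q) (Λ₉ \ Λt) := by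
  rw [← eq337]
  simp only [chi, sub_sub_cancel]

/-! ## §2 Sharp characteristic functions: the partition of unity selects the small-field region -/

/-- The sharp per-cube characteristic function of a (decidable) per-cube condition `S □` ("the (3.15) conditions hold in □"):
`χ_□ = 1` if `S □`, else `0`. [cite: BalabanImbrieJaffe1988, (3.14) p.267] -/
def indicator (S : κ → Prop) [DecidablePred S] (q : κ) : ℝ := if S q then 1 else 0

/-- `χ_{Λ₀} = 1` exactly when the conditions hold in EVERY cube of `Λ₀`, else `0` — p. 267 *"in each of which the factor
χ_{Λ₀^{(0)}} enforces the following conditions"*. [cite: BalabanImbrieJaffe1988, (3.14) p.267] -/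
theorem chi_indicator (S : κ → Prop) [DecidablePred S] (Λ₀ : Finset κ) :
    chi (indicator S) Λ₀ = if ∀ q ∈ Λ₀, S q then 1 else 0 := by
  simp only [chi, indicator]
  exact prod_boole

/-- `ζ_Y = 1` exactly when the conditions FAIL in every cube of `Y`, else `0` — p. 267 *"The factor ζ_{Λ₀^{(0)c}} forces at least
one of these conditions to be violated somewhere in each r(e₀)-cube of Λ₀^{(0)c}"*. [cite: BalabanImbrieJaffe1988, (3.14) p.267] -/
theorem zeta_indicator (S : κ → Prop) [DecidablePred S] (Y : Finset κ) :
    zeta (indicator S) Y = if ∀ q ∈ Y, ¬ S q then 1 else 0 := by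
  simp only [zeta, indicator]
  have : ∀ q, (1 : ℝ) - (if S q then 1 else 0) = if ¬ S q then 1 else 0 := fun q => by
    split_ifs <;> simp_all
  simp only [this]
  exact prod_boole

/-- The small-field region selected by sharp characteristic functions: the cubes of `cubes` in which the conditions hold.
[cite: BalabanImbrieJaffe1988, (3.14) p.267] -/
def smallRegion (S : κ → Prop) [DecidablePred S] (cubes : Finset κ) : Finset κ := cubes.filter S

/-- For sharp characteristic functions the term `ζ_{cubes ∖ Λ₀} χ_{Λ₀}` of (3.14) is `1` for `Λ₀ =` the small-field region and `0`
for every other `Λ₀ ⊆ cubes`: the partition of unity DECOMPOSES each field configuration into exactly one large/small-field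
assignment. [cite: BalabanImbrieJaffe1988, (3.14) p.267] -/
theorem term314_indicator [DecidableEq κ] (S : κ → Prop) [DecidablePred S] {cubes Λ₀ : Finset κ} (hΛ : Λ₀ ⊆ cubes) :
    zeta (indicator S) (cubes \ Λ₀) * chi (indicator S) Λ₀ = if Λ₀ = smallRegion S cubes then 1 else 0 := by
  rw [zeta_indicator, chi_indicator]
  by_cases h : Λ₀ = smallRegion S cubes
  · subst h
    have h1 : ∀ q ∈ cubes \ smallRegion S cubes, ¬ S q := fun q hq => by
      simp only [smallRegion, mem_sdiff, mem_filter] at hq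
      exact fun hS => hq.2 ⟨hq.1, hS⟩
    have h2 : ∀ q ∈ smallRegion S cubes, S q := fun q hq => (mem_filter.1 hq).2
    rw [if_pos h1, if_pos h2, if_pos rfl, one_mul]
  · rw [if_neg h]
    by_cases hall : ∀ q ∈ Λ₀, S q
    · have hex : ¬ ∀ q ∈ cubes \ Λ₀, ¬ S q := by
        intro hc
        apply h
        ext q
        simp only [smallRegion, mem_filter]
        constructor
        · exact fun hq => ⟨hΛ hq, hall q hq⟩
        · rintro ⟨hqc, hS⟩
          by_contra hq
          exact hc q (mem_sdiff.2 ⟨hqc, hq⟩) hS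
      rw [if_neg hex, zero_mul]
    · rw [if_neg hall, mul_zero]

/-- (3.14) for sharp characteristic functions, with its support made explicit: the sum equals its single term at the small-field
region (which is `1`). [cite: BalabanImbrieJaffe1988, (3.14) p.267] -/
theorem eq314_indicator_support [DecidableEq κ] (S : κ → Prop) [DecidablePred S] (cubes : Finset κ) :
    ∑ Λ₀ ∈ cubes.powerset, zeta (indicator S) (cubes \ Λ₀) * chi (indicator S) Λ₀ =
      zeta (indicator S) (cubes \ smallRegion S cubes) * chi (indicator S) (smallRegion S cubes) := by
  rw [eq314, term314_indicator S (cubes := cubes) (Λ₀ := smallRegion S cubes) (filter_subset S cubes), if_pos rfl]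

/-! ## §3 The instance of (3.15): `χ_□` = indicator of `BIJ88Sect3Statements.SmallField315` on the cube `□` -/

open Literature.MathematicalPhysics.QuantumFieldTheory.Balaban1983to89

variable {P : Params} {j : ℕ}

/-- The small-field region `Λ₀ ⊂ T₁` as a set of SITES: the union of the sites of its cubes (p. 267: *"Λ₀^{(0)} ⊂ T₁ is the small
field region. It is composed of r(e₀)-cubes"*; the cube geometry `sites □` is data). [cite: BalabanImbrieJaffe1988, (3.14) p.267] -/
def regionSites [DecidableEq (Balaban1983to89.Site P j)] (sites : κ → Finset (Balaban1983to89.Site P j)) (Λ₀ : Finset κ) :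
    Finset (Balaban1983to89.Site P j) :=
  Λ₀.biUnion sites

open Classical in
/-- `χ_□` for the (3.15) conditions: the indicator that `BIJ88Sect3Statements.SmallField315 p(e₀) λ₀` holds on the sites `sites □`
and block sites `blockSites □` of the cube `□`, for the field values `D_uφ`, `ψ`, `Q(u)φ`, `φ`, `f^{(0)}`.
[cite: BalabanImbrieJaffe1988, (3.15) p.267] -/
def chi315 (pe₀ lam₀ : ℝ) (sites : κ → Finset (Balaban1983to89.Site P j)) (blockSites : κ → Finset (Balaban1983to89.Site P (j + 1)))
    (Dφ : PBond P j → ℂ) (ψ Qφ : Balaban1983to89.Site P (j + 1) → ℂ) (φ : Balaban1983to89.Site P j → ℂ) (f0 : Plaq P j → ℝ)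
    (q : κ) : ℝ :=
  indicator (fun q => BIJ88Sect3Statements.SmallField315 pe₀ lam₀ (sites q) (blockSites q) Dφ ψ Qφ φ f0) q

/-- `χ_□ ∈ {0, 1}` for the (3.15) indicator. [cite: BalabanImbrieJaffe1988, (3.15) p.267] -/
theorem chi315_eq_one_or_zero (pe₀ lam₀ : ℝ) (sites : κ → Finset (Balaban1983to89.Site P j))
    (blockSites : κ → Finset (Balaban1983to89.Site P (j + 1))) (Dφ : PBond P j → ℂ) (ψ Qφ : Balaban1983to89.Site P (j + 1) → ℂ)
    (φ : Balaban1983to89.Site P j → ℂ) (f0 : Plaq P j → ℝ) (q : κ) :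
    chi315 pe₀ lam₀ sites blockSites Dφ ψ Qφ φ f0 q = 1 ∨ chi315 pe₀ lam₀ sites blockSites Dφ ψ Qφ φ f0 q = 0 := by
  unfold chi315 indicator
  split_ifs <;> simp

/-- **(3.14)** for the abelian Higgs model's small-field conditions (3.15): for every field configuration and every finite set of
r(e₀)-cubes, `Σ_{Λ₀ ⊆ cubes} ζ_{cubes ∖ Λ₀} χ_{Λ₀} = 1` with `χ_□` the (3.15) indicator. [cite: BalabanImbrieJaffe1988, (3.14) p.267] -/
theorem eq314_smallField [DecidableEq κ] (cubes : Finset κ) (pe₀ lam₀ : ℝ) (sites : κ → Finset (Balaban1983to89.Site P j))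
    (blockSites : κ → Finset (Balaban1983to89.Site P (j + 1))) (Dφ : PBond P j → ℂ) (ψ Qφ : Balaban1983to89.Site P (j + 1) → ℂ)
    (φ : Balaban1983to89.Site P j → ℂ) (f0 : Plaq P j → ℝ) :
    ∑ Λ₀ ∈ cubes.powerset, zeta (chi315 pe₀ lam₀ sites blockSites Dφ ψ Qφ φ f0) (cubes \ Λ₀) *
      chi (chi315 pe₀ lam₀ sites blockSites Dφ ψ Qφ φ f0) Λ₀ = 1 :=
  eq314 cubes _

open Classical in
/-- For the (3.15) indicator the only surviving term of (3.14) is the small-field region `{□ ∈ cubes : (3.15) holds in □}`.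
[cite: BalabanImbrieJaffe1988, (3.14) p.267] -/
theorem term314_smallField (cubes Λ₀ : Finset κ) (hΛ : Λ₀ ⊆ cubes) (pe₀ lam₀ : ℝ)
    (sites : κ → Finset (Balaban1983to89.Site P j)) (blockSites : κ → Finset (Balaban1983to89.Site P (j + 1))) (Dφ : PBond P j → ℂ)
    (ψ Qφ : Balaban1983to89.Site P (j + 1) → ℂ) (φ : Balaban1983to89.Site P j → ℂ) (f0 : Plaq P j → ℝ) :
    zeta (chi315 pe₀ lam₀ sites blockSites Dφ ψ Qφ φ f0) (cubes \ Λ₀) * chi (chi315 pe₀ lam₀ sites blockSites Dφ ψ Qφ φ f0) Λ₀ =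
      if Λ₀ = smallRegion (fun q => BIJ88Sect3Statements.SmallField315 pe₀ lam₀ (sites q) (blockSites q) Dφ ψ Qφ φ f0) cubes
      then 1 else 0 :=
  term314_indicator _ hΛ

end

end Literature.MathematicalPhysics.QuantumFieldTheory.BalabanImbrieJaffe1984to88.BIJ88Decomposition314
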